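import Literature.NumberTheory.LFunctions.BPZFirstMomentSingularSum
import HarnessLib

/-!
# Bui–Pratt–Zaharescu 2024, §4 at order zero: the mollified moment of the central VALUE of the
# product `Λ_{f,ψ}(½) = Λ(f,½)Λ(f⊗ψ,½)` — a DERIVATION TARGET (not printed), and its purity

Source: H. M. Bui, K. Pratt, A. Zaharescu, *Analytic ranks of automorphic L-functions and
Landau–Siegel zeros*, J. London Math. Soc. 109 (2024) e12834 = arXiv:2102.03087 [held:
paper:arxiv-2102.03087]: Lemma 3.4 (p. 7), the display of §4 and (4.1) (p. 11), the residues printed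
for `k = 1, 2` (p. 11 bottom – p. 12 top), Lemma 5.1 (p. 12), Theorem 1.2 (p. 3). Continues
`BPZProductMollifiedMoments` (typer-2, Props. 2.1–2.3) and `BPZFirstMomentSingularSum` (typer-1,
§4 displays at `k = 1, 2`, `S₁(u)`), same namespace `BPZ2024`, same conventions (`q` prime, `ψ` real
odd primitive mod `D`, «`D` large» = `∃ D₀`, «`L(1,ψ) log D = o(1)`» = `∃ δ₀ > 0`, one constant `K`
per `ε`).

Typed for the LANDAU–SIEGEL PROGRAMME, cell `landau-siegel`, §B-fam, registry row famE-14 = E-096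
(«E-fam-prodpurity», B-fam/EDLIST.md v1.8; REF-B3 F1): the ORDER-0 product purity display that the
(A)-world consistency exhibits of the B-fam kill certificate (KILL-draft §1 (III)) bind to.

## What print gives and what it does not (pages read 2026-08-26)

* Lemma 3.4 [p0007:L57] is stated «Let `k ∈ ℕ`» and gives, for the BPZ test function `G`
  (`G(0) = 1`, `G^{(j)}(0) = 0` for `1 ≤ j ≤ k`),
  `Λ^{(k)}_{f,ψ}(½) = k!(1 + (−1)^{k+1}ψ(q)) Σ_{(d,q)=1} ψ(d)/d Σ_n (1⋆ψ)(n)λ_f(n)n^{−1/2} V_k(d²n/Q)`,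
  `Q = qD/4π²`; the §4 display [p0011:L27–L86] turns the mollified harmonic average into
  `k!(1 + (−1)^{k+1}ψ(q)) (1/2πi)∫_{(1)} G(u)Γ(1+u)² Q^u L(1+2u,ψ) S₁(u) du/u^{k+1} + O_ε(q^{−1/2+ε}DX)`
  with `S₁(u) = Σ_{n≤X} ρ₁(n)(1⋆ψ)(n)n^{−1−u}` (4.1), and the residue at `u = 0` is PRINTED ONLY for
  `k = 1` (`2(1+ψ(q))S₁(0)L′(1,ψ) + O_ε(L(1,ψ)(log q)^{5+ε})`) and `k = 2` [p0011:L102–p0012:L10]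
  — typed as `buiPrattZaharescu2024_section4_first/_second` (p464253).
* NOT PRINTED: the `k = 0` instance. The same chain at `k = 0` (the proof of Lemma 3.4 is verbatim:
  Cauchy's theorem with a SIMPLE pole, the conditions on `G^{(j)}(0)` being vacuous; the contour shift
  of §4 crosses the simple pole of `G(u)Γ(1+u)²Q^uL(1+2u,ψ)S₁(u)/u` at `u = 0` with residue
  `G(0)Γ(1)²Q⁰L(1,ψ)S₁(0) = L(1,ψ)S₁(0)`, the shifted integral being `≪_ε q^{−1/2+ε}X^{1/2}` as on
  p. 11) gives
  `Σʰ_{f∈S₂*(q)} Λ_{f,ψ}(½) M_{f,ψ} = (1 − ψ(q)) · S₁(0) · L(1,ψ) + O_ε(q^{−1/2+ε}(X^{1/2} + DX))`: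
  the main term is PURE — proportional to `L(1,ψ)`, with NO `L′(1,ψ)` term (no derivative can appear
  at a simple pole) — the product-mollified analogue of the purity of Iwaniec's (7.4)
  [IwaniecConversations2006, §7 p. 96]. This is the cell's DERIVATION TARGET `OrderZeroProductMoment`
  below (a `Prop`, nothing asserted); nearest printed statements: the `k = 1, 2` displays above.
* Theorem 1.2, compatible clause [p0003:L25–L45] (typed by ls-lit-typer-3 as
  `buiPrattZaharescu2024_theorem12_*`, `AnalyticRanksLandauSiegel`): at prime levels `q` with
  `ψ(q) = −1` (the cell's COMPATIBLE class `χ(−q) = +1` for odd `ψ`) and `L(1,ψ) log D = o(1)`,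
  «`r_f ≤ 2` for almost all `f ∈ S₂*(q)`» — it bounds RANKS through the product `Λ_{f,ψ}` and does
  NOT split the compatible class into `r_f = 0 | r_f = 2`: no proportion of `L(½,f) ≠ 0` beyond one
  half is asserted there (the `r_f ≤ 1`, i.e. `= 1 − o(1)`, statement is the INCOMPATIBLE case
  `ψ(q) = +1`).

## What is typed

* `BPZ2024.OrderZeroProductMoment` — the `k = 0` display as a named DERIVATION TARGET (`Prop`; BPZ's
  provisos `q, X ≥ D⁸` and standing hypotheses carried verbatim from the `k = 1` display so that the
  three orders read uniformly; the error is recorded as `K·q^{−1/2+ε}DX`, which dominates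
  `q^{−1/2+ε}X^{1/2}` for `X ≥ 1`).
* PROVED bookkeeping: `LambdaProdDeriv_zero` (`Λ^{(0)}_{f,ψ}(½)` is the central value of the product),
  (private) `norm_one_sub_quadratic_le_two` (`‖1 − ψ(q)‖ ≤ 2`), and `orderZero_moment_norm_le`: GIVEN the target,
  `‖Σʰ Λ_{f,ψ}(½)M_{f,ψ}‖ ≤ 2‖S₁(0)‖·‖L(1,ψ)‖ + K q^{−1/2+ε}DX` — «if `L(1,χ)` is very small then almost
  all the products are very small» in mollified form, the binder of the (III) exhibits.

FRAMING: «The programme SEARCHES and TYPES; no claim about Landau–Siegel zeros, Theorems 1–2 of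
arXiv:2211.02515 or a repaired Margin232 until a kernel theorem says so.» Nothing in this file is
asserted about `𝓗₂(q)`; the one `Prop` is a derivation target, not a fact.

## References

* [BuiPrattZaharescu2023] Lemma 3.4 p. 7; §4 p. 11, (4.1); p. 12 top; Lemma 5.1 p. 12; Thm. 1.2 p. 3
  (held text pages p0003, p0007, p0011, p0012).
* [IwaniecConversations2006] §7 (7.4) and «purity», LNM 1891 p. 96 (held chunk p0096:L25).
-/

noncomputable section

open scoped Real
open CongruenceSubgroup Complex Finset
open Literature.NumberTheory.EllipticCurves.ModularForms

namespace Literature.NumberTheory.LFunctions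

namespace BPZ2024

variable (q : ℕ) {D : ℕ}

/-- `Λ^{(0)}_{f,ψ}(½) = Λ_{f,ψ}(½)`: the zeroth «derivative» of the product is its central value
(`u = 0` in the `u`-variable of `LambdaProd`). [cite: BuiPrattZaharescu2023, §2 (2.2)] -/
theorem LambdaProdDeriv_zero (ψ : DirichletCharacter ℂ D) (f : CuspForm (Gamma0 q) 2) :
    LambdaProdDeriv q ψ 0 f = LambdaProd q ψ f 0 := by
  unfold LambdaProdDeriv
  rw [iteratedDeriv_zero]

/-- For a quadratic character, `‖1 − ψ(a)‖ ≤ 2` (`ψ(a) ∈ {0, 1, −1}`); so the parity factor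
`1 − ψ(q)` of the order-0 display is `0` (incompatible prime level, forced central zero) or `2`
(compatible), and never larger. [folklore] -/
private theorem norm_one_sub_quadratic_le_two {ψ : DirichletCharacter ℂ D} (hψ : MulChar.IsQuadratic ψ)
    (a : ZMod D) : ‖(1 : ℂ) - ψ a‖ ≤ 2 := by
  rcases hψ a with h | h | h <;> rw [h] <;> norm_num

/-- **famE-14 / E-096 — THE ORDER-0 MOLLIFIED PRODUCT MOMENT (DERIVATION TARGET, NOT PRINTED).**
The `k = 0` instance of BPZ's first-moment chain (Lemma 3.4 + the §4 display, p. 11), with the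
provisos of the printed `k = 1` display carried verbatim (`D` large, `ψ` real odd primitive mod `D`,
`L(1,ψ) log D ≤ δ₀`, `q` prime, `q, X ≥ D⁸`): for every `ε > 0` there are `K, δ₀ > 0`, `D₀` with
`‖Σʰ_{f∈S₂*(q)} Λ_{f,ψ}(½) M_{f,ψ} − (1 − ψ(q)) · S₁(0) · L(1,ψ)‖ ≤ K · q^{−1/2+ε} D X`.
PURE main term (∝ `L(1,ψ)`, no `L′(1,ψ)`: simple pole). NOT PRINTED — BPZ state Lemma 3.4 for
`k ∈ ℕ` and print the residues for `k = 1, 2` only [p0011:L102–p0012:L10]; nearest printed results: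
`buiPrattZaharescu2024_section4_first` / `_second` (p464253). A derivation target of the cell
(B-fam/EDLIST famE-14): NOTHING IS ASSERTED; consumers take `(h : OrderZeroProductMoment)`.
[cite: BuiPrattZaharescu2023, §4 (p. 11, display and (4.1); k = 0 instance not printed)] -/
def OrderZeroProductMoment : Prop :=
  ∀ ε : ℝ, 0 < ε →
    ∃ K : ℝ, 0 < K ∧ ∃ δ₀ : ℝ, 0 < δ₀ ∧ ∃ D₀ : ℕ, ∀ (D : ℕ) [NeZero D], D₀ ≤ D →
      ∀ ψ : DirichletCharacter ℂ D, ψ.IsPrimitive → ψ.IsQuadratic → ψ.Odd →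
        ‖ψ.LFunction 1‖ * Real.log D ≤ δ₀ →
        ∀ (q : ℕ) [NeZero q], q.Prime → (D : ℝ) ^ (8 : ℝ) ≤ (q : ℝ) → ∀ X : ℝ, (D : ℝ) ^ (8 : ℝ) ≤ X →
          ‖GL2Family.harmonicSum q 2 (fun f ↦ LambdaProdDeriv q ψ 0 f * mollifier q ψ X f) -
              (1 - ψ (q : ZMod D)) * S1u ψ X 0 * ψ.LFunction 1‖ ≤
            K * ((q : ℝ) ^ (-(1 / 2 : ℝ) + ε) * D * X)

/-- **Purity in use («almost all the products are very small»).** GIVEN the order-0 target, for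
every `ε > 0` there are `K, δ₀ > 0`, `D₀` such that under the same provisos
`‖Σʰ_{f∈S₂*(q)} Λ_{f,ψ}(½) M_{f,ψ}‖ ≤ 2 · ‖S₁(0)‖ · ‖L(1,ψ)‖ + K · q^{−1/2+ε} D X`:
the mollified order-0 product moment is `O(L(1,ψ))` — tiny when `L(1,ψ) log D = o(1)` (with
`S₁(0) = S₁ + O(…)`, `S₁ ≤ 1`, Lemma 5.1 p. 12 / p. 15), which is what the (III) exhibits of the B-fam
kill certificate bind to. Proved bookkeeping (triangle inequality and `‖1 − ψ(q)‖ ≤ 2`).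
[cite: BuiPrattZaharescu2023, §4 (p. 11; k = 0 instance) and Thm. 1.2 (p. 3)] -/
theorem orderZero_moment_norm_le (h : OrderZeroProductMoment) :
    ∀ ε : ℝ, 0 < ε →
      ∃ K : ℝ, 0 < K ∧ ∃ δ₀ : ℝ, 0 < δ₀ ∧ ∃ D₀ : ℕ, ∀ (D : ℕ) [NeZero D], D₀ ≤ D →
        ∀ ψ : DirichletCharacter ℂ D, ψ.IsPrimitive → ψ.IsQuadratic → ψ.Odd →
          ‖ψ.LFunction 1‖ * Real.log D ≤ δ₀ →
          ∀ (q : ℕ) [NeZero q], q.Prime → (D : ℝ) ^ (8 : ℝ) ≤ (q : ℝ) →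
            ∀ X : ℝ, (D : ℝ) ^ (8 : ℝ) ≤ X →
              ‖GL2Family.harmonicSum q 2 (fun f ↦ LambdaProdDeriv q ψ 0 f * mollifier q ψ X f)‖ ≤
                2 * ‖S1u ψ X 0‖ * ‖ψ.LFunction 1‖ + K * ((q : ℝ) ^ (-(1 / 2 : ℝ) + ε) * D * X) := by
  intro ε hε
  obtain ⟨K, hK, δ₀, hδ₀, D₀, hD⟩ := h ε hε
  refine ⟨K, hK, δ₀, hδ₀, D₀, fun D _ hDD ψ hprim hquad hodd hsmall q _ hq hqD X hX => ?_⟩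
  have hmain := hD D hDD ψ hprim hquad hodd hsmall q hq hqD X hX
  set A := GL2Family.harmonicSum q 2 (fun f ↦ LambdaProdDeriv q ψ 0 f * mollifier q ψ X f) with hA
  set B := (1 - ψ (q : ZMod D)) * S1u ψ X 0 * ψ.LFunction 1 with hB
  have hBn : ‖B‖ ≤ 2 * ‖S1u ψ X 0‖ * ‖ψ.LFunction 1‖ := by
    rw [hB, norm_mul, norm_mul]
    have h2 := norm_one_sub_quadratic_le_two hquad (q : ZMod D)
    have hn1 : 0 ≤ ‖S1u ψ X 0‖ := norm_nonneg _
    have hn2 : 0 ≤ ‖ψ.LFunction 1‖ := norm_nonneg _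
    have h3 : ‖(1 : ℂ) - ψ (q : ZMod D)‖ * ‖S1u ψ X 0‖ ≤ 2 * ‖S1u ψ X 0‖ :=
      mul_le_mul_of_nonneg_right h2 hn1
    exact mul_le_mul_of_nonneg_right h3 hn2
  have htri : ‖A‖ ≤ ‖A - B‖ + ‖B‖ := by
    have h4 := norm_add_le (A - B) B
    rwa [sub_add_cancel] at h4
  linarith

end BPZ2024

end Literature.NumberTheory.LFunctions

end
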